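import Summits.FinalStateConjecture.FinalStateConjecture.Theorems.PhotonSphereChannelsChannelsResolveTameDevelopmentsRDockReadyTransferNR
import HarnessLib

/-!
# Route PhotonSphereChannels · crux `ChannelsResolveTameDevelopmentsR` (K2R-T2, stmt-FinalStateConjecture-17430) ·
# line `tame-lasalle-dock` · stubs D/N: the transfer through a representative needs neither an orientation clause on the
# embedding nor uniqueness of Kerr parameters — the RAW dichotomy is pushed forward and re-processed in the element

The transfer files (`…RHullRigidGivenSEK`, `…RDockReadyTransfer(NR)`) (1) state the no-extremal-shadow side condition (G5) as
"every Kerr exterior `(M', a)`, `|a| ≤ M'`, injectively locally isometric onto `E.doc` has `|a| < M'`" — for an element whose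
d.o.c. IS a sub-extremal Kerr exterior this contains the uniqueness fact "an extremal Kerr exterior is not isometric to a
sub-extremal one", a slice of the parameter-uniqueness problem (U) of stub K♭ — and (2) ask the representative's embedding `j`
to map future-directed vectors to future-directed vectors, in order to push an EXACT, ORIENTED chart forward. Neither is needed:
SEK's raw output for the representative (a Kerr exterior up to orientation with `|a| ≤ M'`, or flatness) can be pushed forward
along ANY injective local isometry `j` (`kerrExteriorUpToOrientation_image`) and re-processed IN THE ELEMENT: re-identified as
sub-extremal by the weaker side condition (G5♭) "a Kerr-looking d.o.c. also looks sub-extremal" and oriented/exactified there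
(`orientationFix_of_subextremal`, `isKerrDoc_of_isLocalIsometry`). This file proves:

* `kerrExterior_or_isMinkowski_of_nonRadiating` — the RAW dichotomy for one non-radiating end in an all-orders class of a
  globally hyperbolic, black-hole-or-complete spacetime: `E.doc` is a Kerr exterior up to orientation (`0 < M'`, `|a| ≤ M'`) or
  `𝓢` is Minkowski;
* `isMinkowski_or_exists_isKerrDoc_of_nonRadiating_flat` — + (G5♭) ⇒ `IsMinkowski 𝓢 ∨` EXACT sub-extremal Kerr d.o.c.;
* `isMinkowski_or_isKerrDoc_of_dockReady_flat` (registered sub-goal of stmt-FinalStateConjecture-17430) — the per-element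
  transfer through a dock-ready representative with NO orientation clause on `j`, non-radiation only, and (G5♭).

Consequence for the skeleton (Reshape 1c/1d of lead c8): stub D's case A drops the clause on `dj` and asks only non-radiation of
the representative; stub N is stated in the ♭ form. No route item is restated.

References: O'Neill 1983, Ch. 3, pp. 90–91; Ch. 5, p. 145 [ONeill1983]; Dafermos–Luk 2017, Conjecture 1 [DafermosLuk2017];
Alexakis–Ionescu–Klainerman 2010, Thm. 1.1 [AlexakisIonescuKlainerman2009].
-/

noncomputable section

-- the operator-norm instance on `E4 →L[ℝ] E4 →L[ℝ] ℝ` needs one more level of pending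
-- instance problems than the default (as in `PhotonSphereChannelsTameHullDefs.lean`)
set_option maxSynthPendingDepth 3
-- every `Summit.FinalStateConjecture.FinalStateConjecture.…` name repeats the summit = sub-problem segment (D-0017 layout)
set_option linter.dupNamespace false

open Set Filter Function TopologicalSpace Manifold Bundle
open scoped Topology Manifold ContDiff ENNReal NNReal

namespace Summit.FinalStateConjecture.FinalStateConjecture.Theorems.TameLaSalle

open Literature.Geometry.Lorentzian
open Summit.FinalStateConjecture.FinalStateConjecture.Theorems.TameHull
open Summit.FinalStateConjecture.FinalStateConjecture.Theorems.DarkFuture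

/-- **The RAW dichotomy for one non-radiating tame eternal end.** SEK + an end `E` of `𝓢` in an all-orders class with
two-sided non-radiating far chart + `𝓢` globally hyperbolic + black-hole w.r.t. the end or timelike+null complete ⇒ `E.doc` is
the image of an injective local isometry of a Kerr exterior `(M', a)`, `0 < M'`, `|a| ≤ M'` (EITHER time orientation), or `𝓢` is
Minkowski (`isMinkowski_of_isIsometry`). The far data of `E` are SEK's definitionally (`E.B/E.h/E.hdot`), the all-orders bounds
are `IsTameClass.order`, all-orders non-radiation is `isNonRadiating_allOrders` (G1) fed by `contDiffAt_farDeviation_of_isTameEnd` (G0).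
[cite: DafermosLuk2017, Conjecture 1] [cite: AlexakisIonescuKlainerman2009, Thm 1.1] -/
theorem kerrExterior_or_isMinkowski_of_nonRadiating [Kerr.Facts]
    (hSEK : ∀ (M R : ℝ) (C : ℕ → ℝ), 0 ≤ M → max (2 * M) 0 < R → ∀ (𝓢 : Literature.Geometry.Lorentzian.Spacetime.{0} 4) [𝓢.metric.toPseudoRiemannianMetric.HasLeviCivita] [Literature.Geometry.Lorentzian.Kerr.Facts], 𝓢.metric.toPseudoRiemannianMetric.IsRicciFlat → 𝓢.metric.IsGloballyHyperbolic 𝓢.timeOrientation → ∀ (Φ : Literature.Geometry.Lorentzian.Kerr.region (0 : ℝ) R → 𝓢.carrier), IsLocalDiffeomorph 𝓘(ℝ, Literature.Geometry.Lorentzian.E4) (𝓡 4) (⊤ : ℕ∞) Φ → Function.Injective Φ → let B : Literature.Geometry.Lorentzian.ModelBackground := ⟨Literature.Geometry.Lorentzian.Kerr.region 0 R, Literature.Geometry.Lorentzian.Kerr.bilin M 0, fun x ↦ x 0, Literature.Geometry.Lorentzian.Kerr.radius 0⟩; let h : Literature.Geometry.Lorentzian.E4 → Literature.Geometry.Lorentzian.E4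 →L[ℝ] Literature.Geometry.Lorentzian.E4 →L[ℝ] ℝ := 𝓢.deviationExtend B Φ; let hₜ : Literature.Geometry.Lorentzian.E4 → Literature.Geometry.Lorentzian.E4 →L[ℝ] Literature.Geometry.Lorentzian.E4 →L[ℝ] ℝ := fun y ↦ fderiv ℝ h y (Literature.Geometry.Lorentzian.E4.basisVector 0); (∀ (m : ℕ) (x : Literature.Geometry.Lorentzian.Kerr.region (0 : ℝ) R), ‖iteratedFDeriv ℝ m h x.1‖ * Literature.Geometry.Lorentzian.Kerr.radius 0 x.1 ≤ C m) → (∀ (m : ℕ), ∀ δ > (0 : ℝ), ∃ R' : ℝ, ∀ x : Literature.Geometry.Lorentzian.Kerr.region (0 : ℝ) R, R' < Literature.Geometry.Lorentzian.Kerr.radius 0 x.1 → ‖iteratedFDeriv ℝ m hₜ x.1‖ * Literature.Geometry.Lorentzian.Kerr.radius 0 x.1 ≤ δ) → ((𝓢.blackHoleRegionOfEnd (Set.range Φ)).Nonempty ∨ (𝓢.metric.IsTimelikeGeodesicallyComplete ∧ 𝓢.metric.IsNullGeodesicallyComplete)) → (∃ (M' a : ℝ), 0 < M' ∧ |a| ≤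 M' ∧ ∃ Ψ : Literature.Geometry.Lorentzian.Kerr.exterior M' a → 𝓢.carrier, Function.Injective Ψ ∧ Set.range Ψ = 𝓢.docOfEnd (Set.range Φ) ∧ Literature.Geometry.Lorentzian.PseudoRiemannianMetric.IsLocalIsometry (Literature.Geometry.Lorentzian.Kerr.smoothMetric M' a (Literature.Geometry.Lorentzian.Kerr.rPlus M' a)).toPseudoRiemannianMetric 𝓢.metric.toPseudoRiemannianMetric Ψ) ∨ (∃ Ψ : Diffeomorph (𝓡 4) 𝓘(ℝ, Literature.Geometry.Lorentzian.E4) 𝓢.carrier Literature.Geometry.Lorentzian.E4 (⊤ : ℕ∞), Literature.Geometry.Lorentzian.PseudoRiemannianMetric.IsIsometry 𝓢.metric.toPseudoRiemannianMetric (Literature.Geometry.Lorentzian.Minkowski.metric.ofLE le_top : Literature.Geometry.Lorentzian.LorentzianMetric 𝓘(ℝ, Literature.Geometry.Lorentzian.E4) (⊤ : ℕ∞) Literature.Geometry.Lorentzian.E4).toPseudoRiemannianMetric Ψ))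
    {𝓢 : Spacetime.{0} 4} [𝓢.metric.HasLeviCivita] (E : EndDatum 𝓢) {Λ : ℕ → ℝ≥0} {r₀ : ℝ}
    (hcls : IsTameClass E Λ r₀) (hnr : E.IsNonRadiating)
    (hGH : 𝓢.metric.IsGloballyHyperbolic 𝓢.timeOrientation)
    (hbh : (𝓢.blackHoleRegionOfEnd (Set.range E.far)).Nonempty ∨
      (𝓢.metric.IsTimelikeGeodesicallyComplete ∧ 𝓢.metric.IsNullGeodesicallyComplete)) :
    (∃ M' a : ℝ, 0 < M' ∧ |a| ≤ M' ∧
      ∃ Ψ : Kerr.exterior M' a → 𝓢.carrier, Function.Injective Ψ ∧ Set.range Ψ = E.doc ∧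
        PseudoRiemannianMetric.IsLocalIsometry
          (Kerr.smoothMetric M' a (Kerr.rPlus M' a)).toPseudoRiemannianMetric
          𝓢.metric.toPseudoRiemannianMetric Ψ) ∨ IsMinkowski 𝓢 := by
  have htame : E.IsTameEnd (Λ 3) r₀ := hcls.isTameEnd
  have hsmooth : ∀ x : Kerr.region (0 : ℝ) E.R, ContDiffAt ℝ ∞ E.h x.1 :=
    contDiffAt_farDeviation_of_isTameEnd E (Λ 3) r₀ htame
  have hM : 0 ≤ E.M := htame.mass_nonneg
  have hR : max (2 * E.M) 0 < E.R := htame.lt_R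
  have hRpos : 0 < E.R := lt_of_le_of_lt (le_max_right _ _) hR
  have hvac : 𝓢.metric.toPseudoRiemannianMetric.IsRicciFlat := htame.vacuum
  have hfar_bound : ∀ k : ℕ, ∀ m ≤ k, ∀ x : Kerr.region (0 : ℝ) E.R,
      ‖iteratedFDeriv ℝ m E.h x.1‖ * Kerr.radius 0 x.1 ≤ Λ k := fun k ↦ (hcls.order k).far_bound
  have hbd : ∀ (m : ℕ) (x : Kerr.region (0 : ℝ) E.R),
      ‖iteratedFDeriv ℝ m E.h x.1‖ * Kerr.radius 0 x.1 ≤ (fun m : ℕ ↦ ((Λ m : ℝ≥0) : ℝ)) m :=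
    fun m x ↦ hfar_bound m m le_rfl x
  have hnonrad : ∀ m : ℕ, ∀ δ > (0 : ℝ), ∃ R' : ℝ, ∀ x : Kerr.region (0 : ℝ) E.R,
      R' < Kerr.radius 0 x.1 → ‖iteratedFDeriv ℝ m E.hdot x.1‖ * Kerr.radius 0 x.1 ≤ δ :=
    isNonRadiating_allOrders E Λ hRpos hsmooth hfar_bound hnr
  have hdich := hSEK E.M E.R (fun m : ℕ ↦ ((Λ m : ℝ≥0) : ℝ)) hM hR 𝓢 hvac hGH E.far
    htame.far_isLocalDiffeomorph htame.far_injective hbd hnonrad hbh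
  rcases hdich with ⟨M', a, hM', ha, Ψ, hinj, hrange, hiso⟩ | ⟨Ψ, hΨ⟩
  · exact Or.inl ⟨M', a, hM', ha, Ψ, hinj, hrange, hiso⟩
  · exact Or.inr (isMinkowski_of_isIsometry Ψ hΨ)

/-- **Re-processing in the element**: a Kerr exterior up to orientation onto `O` + the ♭ side condition (G5♭: a Kerr-looking
`O` admits a sub-extremal re-identification) ⇒ `O` is EXACTLY a sub-extremal Kerr d.o.c. (orientation fix G4b + exactness G4).
[cite: ONeill1995, Ch. 3 §3.1] -/
theorem exists_isKerrDoc_of_kerrExterior_of_flat [Kerr.Facts] {𝓢 : Spacetime.{0} 4} {O : Set 𝓢.carrier}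
    (h : ∃ M' a : ℝ, 0 < M' ∧ |a| ≤ M' ∧
      ∃ Ψ : Kerr.exterior M' a → 𝓢.carrier, Function.Injective Ψ ∧ Set.range Ψ = O ∧
        PseudoRiemannianMetric.IsLocalIsometry
          (Kerr.smoothMetric M' a (Kerr.rPlus M' a)).toPseudoRiemannianMetric
          𝓢.metric.toPseudoRiemannianMetric Ψ)
    (hsub : ∀ M' a : ℝ, 0 < M' → |a| ≤ M' →
      (∃ Ψ : Kerr.exterior M' a → 𝓢.carrier, Function.Injective Ψ ∧ Set.range Ψ = O ∧
        PseudoRiemannianMetric.IsLocalIsometry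
          (Kerr.smoothMetric M' a (Kerr.rPlus M' a)).toPseudoRiemannianMetric
          𝓢.metric.toPseudoRiemannianMetric Ψ) →
      ∃ M₂ a₂ : ℝ, 0 < M₂ ∧ |a₂| < M₂ ∧
        ∃ Ψ₂ : Kerr.exterior M₂ a₂ → 𝓢.carrier, Function.Injective Ψ₂ ∧ Set.range Ψ₂ = O ∧
          PseudoRiemannianMetric.IsLocalIsometry
            (Kerr.smoothMetric M₂ a₂ (Kerr.rPlus M₂ a₂)).toPseudoRiemannianMetric
            𝓢.metric.toPseudoRiemannianMetric Ψ₂) :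
    ∃ M a : ℝ, 0 < M ∧ |a| < M ∧ IsKerrDoc 𝓢 O M a := by
  obtain ⟨M', a, hM', ha, hΨ⟩ := h
  obtain ⟨M₂, a₂, hM₂, ha₂, Ψ₂, hinj₂, hrange₂, hiso₂⟩ := hsub M' a hM' ha hΨ
  obtain ⟨Ψ', hinj', hrange', hiso', hfut'⟩ :=
    orientationFix_of_subextremal O M₂ a₂ hM₂ ha₂ ⟨Ψ₂, hinj₂, hrange₂, hiso₂⟩
  exact ⟨M₂, a₂, hM₂, ha₂, isKerrDoc_of_isLocalIsometry O M₂ a₂ Ψ' hinj' hrange' hiso' hfut'⟩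

/-- **The END-level transfer under non-radiation and (G5♭).** [cite: DafermosLuk2017, Conjecture 1] -/
theorem isMinkowski_or_exists_isKerrDoc_of_nonRadiating_flat [Kerr.Facts]
    (hSEK : ∀ (M R : ℝ) (C : ℕ → ℝ), 0 ≤ M → max (2 * M) 0 < R → ∀ (𝓢 : Literature.Geometry.Lorentzian.Spacetime.{0} 4) [𝓢.metric.toPseudoRiemannianMetric.HasLeviCivita] [Literature.Geometry.Lorentzian.Kerr.Facts], 𝓢.metric.toPseudoRiemannianMetric.IsRicciFlat → 𝓢.metric.IsGloballyHyperbolic 𝓢.timeOrientation → ∀ (Φ : Literature.Geometry.Lorentzian.Kerr.region (0 : ℝ) R → 𝓢.carrier), IsLocalDiffeomorph 𝓘(ℝ, Literature.Geometry.Lorentzian.E4) (𝓡 4) (⊤ : ℕ∞) Φ → Function.Injective Φ → let B : Literature.Geometry.Lorentzian.ModelBackground := ⟨Literature.Geometry.Lorentzian.Kerr.region 0 R, Literature.Geometry.Lorentzian.Kerr.bilin M 0, fun x ↦ x 0, Literature.Geometry.Lorentzian.Kerr.radius 0⟩; let h : Literature.Geometry.Lorentzian.E4 → Literature.Geometry.Lorentzian.E4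 →L[ℝ] Literature.Geometry.Lorentzian.E4 →L[ℝ] ℝ := 𝓢.deviationExtend B Φ; let hₜ : Literature.Geometry.Lorentzian.E4 → Literature.Geometry.Lorentzian.E4 →L[ℝ] Literature.Geometry.Lorentzian.E4 →L[ℝ] ℝ := fun y ↦ fderiv ℝ h y (Literature.Geometry.Lorentzian.E4.basisVector 0); (∀ (m : ℕ) (x : Literature.Geometry.Lorentzian.Kerr.region (0 : ℝ) R), ‖iteratedFDeriv ℝ m h x.1‖ * Literature.Geometry.Lorentzian.Kerr.radius 0 x.1 ≤ C m) → (∀ (m : ℕ), ∀ δ > (0 : ℝ), ∃ R' : ℝ, ∀ x : Literature.Geometry.Lorentzian.Kerr.region (0 : ℝ) R, R' < Literature.Geometry.Lorentzian.Kerr.radius 0 x.1 → ‖iteratedFDeriv ℝ m hₜ x.1‖ * Literature.Geometry.Lorentzian.Kerr.radius 0 x.1 ≤ δ) → ((𝓢.blackHoleRegionOfEnd (Set.range Φ)).Nonempty ∨ (𝓢.metric.IsTimelikeGeodesicallyComplete ∧ 𝓢.metric.IsNullGeodesicallyComplete)) → (∃ (M' a : ℝ), 0 < M' ∧ |a| ≤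 M' ∧ ∃ Ψ : Literature.Geometry.Lorentzian.Kerr.exterior M' a → 𝓢.carrier, Function.Injective Ψ ∧ Set.range Ψ = 𝓢.docOfEnd (Set.range Φ) ∧ Literature.Geometry.Lorentzian.PseudoRiemannianMetric.IsLocalIsometry (Literature.Geometry.Lorentzian.Kerr.smoothMetric M' a (Literature.Geometry.Lorentzian.Kerr.rPlus M' a)).toPseudoRiemannianMetric 𝓢.metric.toPseudoRiemannianMetric Ψ) ∨ (∃ Ψ : Diffeomorph (𝓡 4) 𝓘(ℝ, Literature.Geometry.Lorentzian.E4) 𝓢.carrier Literature.Geometry.Lorentzian.E4 (⊤ : ℕ∞), Literature.Geometry.Lorentzian.PseudoRiemannianMetric.IsIsometry 𝓢.metric.toPseudoRiemannianMetric (Literature.Geometry.Lorentzian.Minkowski.metric.ofLE le_top : Literature.Geometry.Lorentzian.LorentzianMetric 𝓘(ℝ, Literature.Geometry.Lorentzian.E4) (⊤ : ℕ∞) Literature.Geometry.Lorentzian.E4).toPseudoRiemannianMetric Ψ))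
    {𝓢 : Spacetime.{0} 4} [𝓢.metric.HasLeviCivita] (E : EndDatum 𝓢) {Λ : ℕ → ℝ≥0} {r₀ : ℝ}
    (hcls : IsTameClass E Λ r₀) (hnr : E.IsNonRadiating)
    (hGH : 𝓢.metric.IsGloballyHyperbolic 𝓢.timeOrientation)
    (hbh : (𝓢.blackHoleRegionOfEnd (Set.range E.far)).Nonempty ∨
      (𝓢.metric.IsTimelikeGeodesicallyComplete ∧ 𝓢.metric.IsNullGeodesicallyComplete))
    (hsub : ∀ M' a : ℝ, 0 < M' → |a| ≤ M' →
      (∃ Ψ : Kerr.exterior M' a → 𝓢.carrier, Function.Injective Ψ ∧ Set.range Ψ = E.doc ∧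
        PseudoRiemannianMetric.IsLocalIsometry
          (Kerr.smoothMetric M' a (Kerr.rPlus M' a)).toPseudoRiemannianMetric
          𝓢.metric.toPseudoRiemannianMetric Ψ) →
      ∃ M₂ a₂ : ℝ, 0 < M₂ ∧ |a₂| < M₂ ∧
        ∃ Ψ₂ : Kerr.exterior M₂ a₂ → 𝓢.carrier, Function.Injective Ψ₂ ∧ Set.range Ψ₂ = E.doc ∧
          PseudoRiemannianMetric.IsLocalIsometry
            (Kerr.smoothMetric M₂ a₂ (Kerr.rPlus M₂ a₂)).toPseudoRiemannianMetric
            𝓢.metric.toPseudoRiemannianMetric Ψ₂) :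
    IsMinkowski 𝓢 ∨ ∃ M a : ℝ, 0 < M ∧ |a| < M ∧ IsKerrDoc 𝓢 E.doc M a := by
  rcases kerrExterior_or_isMinkowski_of_nonRadiating hSEK E hcls hnr hGH hbh with hK | hflat
  · exact Or.inr (exists_isKerrDoc_of_kerrExterior_of_flat hK hsub)
  · exact Or.inl hflat

/-- **The transfer through a dock-ready representative — final form** (registered sub-goal
`isMinkowski_or_isKerrDoc_of_dockReady_flat` of stmt-FinalStateConjecture-17430): non-radiation only, NO orientation clause on the
representative's embedding `j` (the raw dichotomy of the representative is pushed forward along `j` and re-processed in the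
element), and the ♭ side condition (G5♭). This is the glue of Reshape 1c/1d of the skeleton. [cite: DafermosLuk2017, Conjecture 1] -/
theorem isMinkowski_or_isKerrDoc_of_dockReady_flat : ∀ [Kerr.Facts], (∀ (M R : ℝ) (C : ℕ → ℝ), 0 ≤ M → max (2 * M) 0 < R → ∀ (𝓢 : Spacetime.{0} 4) [𝓢.metric.toPseudoRiemannianMetric.HasLeviCivita] [Kerr.Facts], 𝓢.metric.toPseudoRiemannianMetric.IsRicciFlat → 𝓢.metric.IsGloballyHyperbolic 𝓢.timeOrientation → ∀ (Φ : Kerr.region (0 : ℝ) R → 𝓢.carrier), IsLocalDiffeomorph 𝓘(ℝ, E4) (𝓡 4) (⊤ : ℕ∞) Φ → Function.Injective Φ → let B : ModelBackground := ⟨Kerr.region 0 R, Kerr.bilin M 0, fun x ↦ x 0, Kerr.radius 0⟩; let h : E4 → E4 →L[ℝ] E4 →L[ℝ] ℝ := 𝓢.deviationExtend B Φ; let hₜ : E4 → E4 →L[ℝ] E4 →L[ℝ] ℝ := fun y ↦ fderiv ℝ h y (E4.basisVector 0); (∀ (m : ℕ) (x : Kerr.region (0 : ℝ) R), ‖iteratedFDeriv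 ℝ m h x.1‖ * Kerr.radius 0 x.1 ≤ C m) → (∀ (m : ℕ), ∀ δ > (0 : ℝ), ∃ R' : ℝ, ∀ x : Kerr.region (0 : ℝ) R, R' < Kerr.radius 0 x.1 → ‖iteratedFDeriv ℝ m hₜ x.1‖ * Kerr.radius 0 x.1 ≤ δ) → ((𝓢.blackHoleRegionOfEnd (Set.range Φ)).Nonempty ∨ (𝓢.metric.IsTimelikeGeodesicallyComplete ∧ 𝓢.metric.IsNullGeodesicallyComplete)) → (∃ (M' a : ℝ), 0 < M' ∧ |a| ≤ M' ∧ ∃ Ψ : Kerr.exterior M' a → 𝓢.carrier, Function.Injective Ψ ∧ Set.range Ψ = 𝓢.docOfEnd (Set.range Φ) ∧ PseudoRiemannianMetric.IsLocalIsometry (Kerr.smoothMetric M' a (Kerr.rPlus M' a)).toPseudoRiemannianMetric 𝓢.metric.toPseudoRiemannianMetric Ψ) ∨ (∃ Ψ : Diffeomorph (𝓡 4) 𝓘(ℝ, E4) 𝓢.carrier E4 (⊤ : ℕ∞), PseudoRiemannianMetric.IsIsometry 𝓢.metric.toPseudoRiemannianMetric (Minkowski.metric.ofLE le_top : LorentzianMetric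 𝓘(ℝ, E4) (⊤ : ℕ∞) E4).toPseudoRiemannianMetric Ψ)) → ∀ {𝓢 : Spacetime.{0} 4} [𝓢.metric.HasLeviCivita] (E : EndDatum 𝓢) {Λ : ℕ → ℝ≥0} {r₀ : ℝ}, IsTameClass E Λ r₀ → E.IsNonRadiating → ((𝓢.metric.IsGloballyHyperbolic 𝓢.timeOrientation ∧ 𝓢.metric.IsTimelikeGeodesicallyComplete ∧ 𝓢.metric.IsNullGeodesicallyComplete) ∨ (∃ (𝓢' : Spacetime.{0} 4) (E' : EndDatum 𝓢') (Λ' : ℕ → ℝ≥0) (r₀' : ℝ) (j : 𝓢'.carrier → 𝓢.carrier), IsTameClass E' Λ' r₀' ∧ E'.IsNonRadiating ∧ (∀ [𝓢'.metric.HasLeviCivita], 𝓢'.metric.IsGloballyHyperbolic 𝓢'.timeOrientation ∧ ((𝓢'.blackHoleRegionOfEnd (Set.range E'.far)).Nonempty ∨ (𝓢'.metric.IsTimelikeGeodesicallyComplete ∧ 𝓢'.metric.IsNullGeodesicallyComplete))) ∧ Function.Injective j ∧ PseudoRiemannianMetric.IsLocalIsometry 𝓢'.metric.toPseudoRiemannianMetric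 𝓢.metric.toPseudoRiemannianMetric j ∧ j '' E'.doc = E.doc ∧ (IsMinkowski 𝓢' → IsMinkowski 𝓢))) → (∀ M' a : ℝ, 0 < M' → |a| ≤ M' → (∃ Ψ : Kerr.exterior M' a → 𝓢.carrier, Function.Injective Ψ ∧ Set.range Ψ = E.doc ∧ PseudoRiemannianMetric.IsLocalIsometry (Kerr.smoothMetric M' a (Kerr.rPlus M' a)).toPseudoRiemannianMetric 𝓢.metric.toPseudoRiemannianMetric Ψ) → ∃ M₂ a₂ : ℝ, 0 < M₂ ∧ |a₂| < M₂ ∧ ∃ Ψ₂ : Kerr.exterior M₂ a₂ → 𝓢.carrier, Function.Injective Ψ₂ ∧ Set.range Ψ₂ = E.doc ∧ PseudoRiemannianMetric.IsLocalIsometry (Kerr.smoothMetric M₂ a₂ (Kerr.rPlus M₂ a₂)).toPseudoRiemannianMetric 𝓢.metric.toPseudoRiemannianMetric Ψ₂) → (IsMinkowski 𝓢 ∨ ∃ M a : ℝ, 0 < M ∧ |a| < M ∧ IsKerrDoc 𝓢 E.doc M a) := by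
  intro _ hSEK 𝓢 _ E Λ r₀ hcls hnr hready hsub
  rcases hready with ⟨hGH, htc, hnc⟩ | ⟨𝓢', E', Λ', r₀', j, hcls', hnr', hGH', hj, hiso, hdoc, hmink⟩
  · exact isMinkowski_or_exists_isKerrDoc_of_nonRadiating_flat hSEK E hcls hnr hGH (Or.inr ⟨htc, hnc⟩) hsub
  · haveI : 𝓢'.metric.HasLeviCivita := 𝓢'.metric.toPseudoRiemannianMetric.hasLeviCivita
    obtain ⟨hGH₁, hbh₁⟩ := hGH'
    rcases kerrExterior_or_isMinkowski_of_nonRadiating hSEK E' hcls' hnr' hGH₁ hbh₁ with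
      ⟨M', a, hM', ha, hΨ'⟩ | hflat
    · -- push SEK's raw Kerr exterior forward along `j`, then re-process in `𝓢`
      have himg := kerrExteriorUpToOrientation_image hj hiso hΨ'
      rw [hdoc] at himg
      exact Or.inr (exists_isKerrDoc_of_kerrExterior_of_flat ⟨M', a, hM', ha, himg⟩ hsub)
    · exact Or.inl (hmink hflat)

end Summit.FinalStateConjecture.FinalStateConjecture.Theorems.TameLaSalle

end
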